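import Summits.QuantumFields.YangMills.Theorems.BalabanUVNodesN15PerCubeGreenDictionary
import HarnessLib

/-!
# N15 = NE2, road (c) — PROGRAMME (PC), towards (PC-A′) «the COVARIANT GRADIENT entries of [B9] (3.42) in per-cube gauges», III: THE DICTIONARY FOR THE COVARIANT DERIVATIVE —
# n15-b's `covD` IS the flat quotient plus a transport species along the shift, it is GAUGE COVARIANT with the SAME site gauge on the left, and after a site operator it IS the
# `μ`-component of dag-n15-a's bond-valued `D_T G`, pulled back to sites (dag-n15-c g26, n15-c∕270)

Cell `pub-ymgap`, seat `pub-ymgap-dag-n15-c` (generation g26; R134 (a), s1; HUMAN RULING D-0062).  `bears_on: R4∕N15 · K3⁸ SpineGivenEndpointR13SepCoPHV (stmt-QuantumFields-27366)`.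
Filed `--kind proof --supports stmt-QuantumFields-27366 --as helper` — COUNT-NEUTRAL.  Theorems only; 0 `def`, 0 `sorry`.  Imports BY NAME n15-c∕266 `…PerCubeGreenDictionary` (through it
n15-b `covD`, `covD_apply` (`…CovariantDerivativeSpecies`), n15-b `fgrad` (`…BackgroundTupleCalculus`), `mmulOp`, `liftEquiv`, `pull`, dag-n15-a∕n15-c `cgrad`, `cgrad_mulVec`
(`…CovariantLandauObjects`)).  Nothing in the tree is modified, no landed name re-declared.

WHY.  n15-c∕269 (`hasMaj_comp_glueInv_smoothCutDressed_localGauges`) composes dag-n15-w3 47's per-cube-gauge glued propagator with a left factor `D` of DISPLAYED covariance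
`D∘M_{u_kᵀ} = M_{v_kᵀ}∘(∇_j + P_k + P^far_k)` and Leibniz rule.  For the site instantiation behind n15-c∕266 the left factor is the covariant derivative `D_{U,μ}` of the `U(m)` field:
THIS FILE is its dictionary — (i) the species split `covD n⁻¹ R e = ∇^n_e + M_{n(R − 1)}∘τ_e^*` (flat quotient + transport species read at the far end), (ii) the GAUGE LAW
`covD η R s∘M_{Wᵀ} = M_{Wᵀ}∘covD η R^W s`, `R^W(x) = W(x)R(x)W(sx)ᵀ` — the SAME site gauge on the left (`v_k = u_k` in 269), (iii) the Leibniz rule 269's `hDleib` needs is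
already landed (n15-c `covD_comp_mulOp_scalar`, `…TwoSpacingGluingCovariant`), (iv) `covD n⁻¹ (T ν) (· + e_ν)∘mulVecLin G = pull_ν∘mulVecLin (D_T·G)` — after a
site operator the covariant derivative IS the `ν`-component of dag-n15-a's bond-valued `cgrad T * G` (n15-c∕261b's `fgrad_comp_mulVecLin_eq_pull` at a live transporter), so the
gradient entry `D_UG′(U)` of (3.42) is `pull_ν∘mulVecLin (cgrad (cvT e U) * cGreen (cvT e U) a)`.

HONEST FRAMING ∕ LIMITS.  Exact finite-dimensional algebra ([B9] (3.23) p.394, (3.42) p.397, (3.50) p.400 = SHAPES); nothing estimated, nothing of [B5]∕[B6]∕[B9] asserted.  NE2⁺ NOT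
PRINTED, NOT proved; N15 NOT discharged (of record: DISCHARGED AS CONSUMED, p687738); K3⁸ OPEN; counts of record UNMOVED (typed 28∕28 · discharged 8∕27); one finite 𝕋⁴ at fixed ε —
NOT infinite volume, NOT OS on ℝ⁴, NOT a mass gap, NOT Clay.  Restate-immune (no Theses import).
-/

set_option autoImplicit false

noncomputable section
open scoped BigOperators Matrix
open Finset

namespace Summit.QuantumFields.YangMills.BalabanUVNodes.N15.Gluing

open Literature.MathematicalPhysics.QuantumFieldTheory.Balaban1983to89
open Literature.MathematicalPhysics.QuantumFieldTheory.Balaban1983to89.T4EtaRateCoeffDefect (pull pull_apply)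
open Literature.MathematicalPhysics.QuantumFieldTheory.Balaban1983to89.B6Prop26Gluing (mulOp)
open Literature.MathematicalPhysics.QuantumFieldTheory.Balaban1983to89.B5Prop11Plancherel (Tor fine unitVec)
open Summit.QuantumFields.YangMills.BalabanUVNodes.N15.MatrixSpecies (mmulOp mmulOp_apply liftMap liftEquiv liftEquiv_apply covD covD_apply)
open Summit.QuantumFields.YangMills.BalabanUVNodes.N15.BackgroundLayer (fgrad fgrad_apply)
open Summit.QuantumFields.YangMills.BalabanUVNodes.N15.CovLandau (cgrad cgrad_mulVec)

/-! ## §1 The covariant derivative: species split, gauge law, Leibniz rule (any carrier) -/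

section Abstract

variable {X ι : Type} [Fintype ι] [DecidableEq ι]

/-- ★ **SPECIES SPLIT**: `covD n⁻¹ R e = ∇^n_e + M_{n(R − 1)}∘τ_e^*` — the flat forward quotient of weight `n` plus the transport species `n(R − 1)` read at the far end of the bond
(n15-c∕269's `∇_j + P_k + P^far_k` once `n(R − 1)` is split under ∕ beyond the cube's cut). [cite: Balaban1985BackgroundPropagators, (3.50) p.400, (3.23) p.394 (shape)] -/
theorem covD_eq_fgrad_add (n : ℝ) (R : X → Matrix ι ι ℝ) (e : X ≃ X) :
    covD n⁻¹ R e = fgrad n (liftEquiv e ι) + mmulOp (fun x => n • (R x - 1)) ∘ₗ pull (liftEquiv e ι) := by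
  refine LinearMap.ext fun f => funext fun p => ?_
  obtain ⟨x, i⟩ := p
  rw [covD_apply, inv_inv, LinearMap.add_apply, Pi.add_apply, LinearMap.comp_apply, fgrad_apply, mmulOp_apply]
  simp only [pull_apply, liftEquiv_apply, Matrix.smul_apply, Matrix.sub_apply, Matrix.one_apply, smul_eq_mul, mul_sub, sub_mul, Finset.sum_sub_distrib, mul_ite, mul_one,
    mul_zero, ite_mul, zero_mul, Finset.sum_ite_eq, Finset.mem_univ, if_true, Finset.mul_sum]
  ring

/-- ★★ **GAUGE LAW**: `covD η R s∘M_{Wᵀ} = M_{Wᵀ}∘covD η R^W s` with `R^W(x) = W(x)R(x)W(sx)ᵀ`, `WᵀW = 1` — the covariant derivative at `x` transforms with the site gauge AT `x`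
(the SAME orthogonal family on the left: n15-c∕269's `v_k = u_k`). [cite: Balaban1985BackgroundPropagators, (3.34)–(3.35) p.396, (3.50) p.400 (shape)] -/
theorem covD_comp_mmulOp_transpose {W : X → Matrix ι ι ℝ} (hW' : ∀ x, (W x)ᵀ * W x = 1) (η : ℝ) (R : X → Matrix ι ι ℝ) (s : X → X) :
    covD η R s ∘ₗ mmulOp (fun x => (W x)ᵀ) = mmulOp (fun x => (W x)ᵀ) ∘ₗ covD η (fun x => W x * R x * (W (s x))ᵀ) s := by
  refine LinearMap.ext fun f => funext fun p => ?_
  obtain ⟨x, i⟩ := p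
  simp only [LinearMap.comp_apply, covD_apply, mmulOp_apply]
  -- both sides in `mulVec` form: `g` the field at the far end, `fx` the field at `x`
  set g : ι → ℝ := fun l => f (s x, l) with hg
  set fx : ι → ℝ := fun l => f (x, l) with hfx
  change η⁻¹ * ((R x *ᵥ ((W (s x))ᵀ *ᵥ g)) i - ((W x)ᵀ *ᵥ fx) i) = ((W x)ᵀ *ᵥ (fun j => η⁻¹ * (((W x * R x * (W (s x))ᵀ) *ᵥ g) j - fx j))) i
  have e2 : (fun j => η⁻¹ * (((W x * R x * (W (s x))ᵀ) *ᵥ g) j - fx j)) = η⁻¹ • ((W x * R x * (W (s x))ᵀ) *ᵥ g - fx) := rfl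
  rw [e2, Matrix.mulVec_smul, Matrix.mulVec_sub, Matrix.mulVec_mulVec, Matrix.mulVec_mulVec, ← Matrix.mul_assoc, ← Matrix.mul_assoc, hW', Matrix.one_mul]
  simp only [Pi.smul_apply, Pi.sub_apply, smul_eq_mul]

-- the multiplication-type LEIBNIZ RULE `covD η R s∘M_h = M_{h∘s}∘covD η R s + M_{η⁻¹(h∘s − h)}` (269's `hDleib`) is ALREADY LANDED: n15-c `covD_comp_mulOp_scalar`
-- (`…TwoSpacingGluingCovariant`) — cite it, do not restate.

end Abstract

/-! ## §2 After a site operator: the `ν`-component of dag-n15-a's bond-valued `D_T G` -/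

section Torus

variable {d : ℕ} (M : Fin (d + 1) → ℕ) [∀ ν, NeZero (M ν)] (n : ℕ) [NeZero n] {ι : Type} [Fintype ι] [DecidableEq ι]

/-- ★★ **`D_{T,ν}∘mulVecLin G = (D_T G)|_ν`**: the covariant forward derivative of weight `n` along `e_ν` with transporter `T_ν`, after a site operator `G`, IS the `ν`-component of
dag-n15-a's bond-valued `cgrad T * G` pulled back to sites (n15-c∕261b `fgrad_comp_mulVecLin_eq_pull` at a live transporter; `cgrad_mulVec` ≡ `covD_apply`).  So the gradient entry of
(3.42) for n15-c∕197's `G′(U) = cGreen (cvT e U) a` reads `pull_ν∘mulVecLin (cgrad (cvT e U) * cGreen (cvT e U) a)`. [cite: Balaban1985BackgroundPropagators, (3.42) p.397, (3.50) p.400 (shape)] -/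
theorem covD_comp_mulVecLin_eq_pull (T : Fin (d + 1) → Tor (fine n M) → Matrix ι ι ℝ) (ν : Fin (d + 1)) (G : Matrix (Tor (fine n M) × ι) (Tor (fine n M) × ι) ℝ) :
    covD (((n : ℕ) : ℝ))⁻¹ (T ν) (fun x => x + unitVec (fine n M) ν) ∘ₗ Matrix.mulVecLin G =
      pull (fun p : Tor (fine n M) × ι => ((p.1, ν), p.2)) ∘ₗ Matrix.mulVecLin (cgrad M n T * G) := by
  refine LinearMap.ext fun f => funext fun p => ?_
  obtain ⟨x, i⟩ := p
  rw [LinearMap.comp_apply, covD_apply, inv_inv, LinearMap.comp_apply, pull_apply, Matrix.mulVecLin_apply, Matrix.mulVecLin_apply, ← Matrix.mulVec_mulVec, cgrad_mulVec]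

/-- ★ … and with no site operator: `D_{T,ν} = pull_ν∘mulVecLin (cgrad T)`. [cite: Balaban1985BackgroundPropagators, (3.50) p.400 (shape)] -/
theorem covD_eq_pull_mulVecLin_cgrad (T : Fin (d + 1) → Tor (fine n M) → Matrix ι ι ℝ) (ν : Fin (d + 1)) :
    covD (((n : ℕ) : ℝ))⁻¹ (T ν) (fun x => x + unitVec (fine n M) ν) = pull (fun p : Tor (fine n M) × ι => ((p.1, ν), p.2)) ∘ₗ Matrix.mulVecLin (cgrad M n T) := by
  have h := covD_comp_mulVecLin_eq_pull M n T ν 1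
  rwa [Matrix.mulVecLin_one, LinearMap.comp_id, Matrix.mul_one] at h

end Torus

end Summit.QuantumFields.YangMills.BalabanUVNodes.N15.Gluing
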